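import Summits.QuantumFields.GaugeBoot.Targets
import Literature.MathematicalPhysics.QuantumFieldTheory.UnitaryCayleyChart
import Literature.RepresentationTheory.CompactGroups.UnitaryTrick
import HarnessLib

/-!
# Gauge-boot: a chart-free small-ball bound for the one-link Haar measure of EVERY compact gauge
# group — `Haar{g : N − Re tr ρ(g) ≤ η} ≥ (η/(9N²))^{N²}` (large-`N` supplement 18, part 1)

HONEST FRAMING (cell `pub-gaugeboot`, page 1 of every file): certified bounds on lattice
expectations at STATED coupling, gauge group, dimension and torus size; NOT a mass gap, NOT a
continuum limit, NOT a string tension, NOT large `N`; NOT Yang–Mills-summit-bearing (barriers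
`FixedCouplingUltralocality`, `PerturbativeInvisibility`).  This file is pure measure theory on a
compact group; it certifies no number of the cell's tables.  The exponent `N²` in `η` (radius
exponent `2N²`, the dimension of the ambient real vector space of complex matrices) is NOT the sharp
one (`dim G / 2`); any power law is what the Laplace argument of part 2 consumes.

## Content

For a compact group `G`, a continuous `N`-dimensional matrix representation `ρ` (`N ≥ 1`) and ANY
left-invariant probability measure `μ` on `G` (in particular the tree's `haarProbability G`):

* `HaarCovering.measure_univ_le_card_mul` — the COVERING LEMMA: if a map `cell : G → α` takes values
  in a finite set `S` and two group elements in the same cell differ by an element of `B`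
  (`cell g = cell h → h⁻¹g ∈ B`), then `μ(G) ≤ #S · μ(B)` (left invariance; no measurability needed);
* `HaarCovering.sub_re_trace_eq_norm_sq` — `N − Re tr ρ(g) = ‖1 − σ(g)‖²_F / 2` for the unitarised
  representation `σ = unitarize ρ` of the tree's `UnitaryTrick` (same character, unitary values), and
  ★ `sub_re_trace_inv_mul_eq` — `N − Re tr ρ(h⁻¹g) = ‖σ(g) − σ(h)‖²_F / 2` (unitary invariance of the
  Hilbert–Schmidt norm): the trace cost of `h⁻¹g` is half the squared Euclidean distance of the
  matrices `σ(g)`, `σ(h)` in `ℂ^{N×N} ≅ ℝ^{2N²}`;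
* ★★ `le_measure_setOf_sub_re_trace_le` — binning the `2N²` real coordinates of `σ(g)` (all in
  `[−1, 1]`) into intervals of length `s = √η/N` gives at most `(⌊2/s⌋ + 1)^{2N²} ≤ (9N²/η)^{N²}` cells,
  two elements of one cell have `N − Re tr ρ(h⁻¹g) ≤ N²s² = η`, so
  **`μ{g : N − Re tr ρ(g) ≤ η} ≥ (η/(9N²))^{N²}` for `0 < η ≤ 1`**;
  `le_haarProbability_setOf_sub_re_trace_le` (the tree's Haar probability measure) and
  `le_haarProbability_suN_sub_re_trace_le` (`SU(N)`, fundamental representation).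

For `SU(2)` the lane's quaternion ball model gives the better `η²/16` (`SU2HaarSmallBall`); for `U(N)`
the tree's `Literature.Barriers.QuantumFields.UnitaryHaarSmallBall` has the sharp exponent via an
operator-norm net, but only for measures on `U(N)` itself.  The point here is generality: every
compact `G`, every continuous `ρ`, no chart, no Lie structure, no Weyl formula.

[folklore] (metric-entropy / covering bound for Haar measure; e.g. S. Szarek, *Metric entropy of
homogeneous spaces*, Banach Center Publ. 43 (1998) for the sharp two-sided version on `U(N)`.)
-/

noncomputable section

open MeasureTheory
open scoped Matrix.Norms.Frobenius ENNReal
open Literature.MathematicalPhysics.QuantumFieldTheory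
open Literature.RepresentationTheory.CompactGroups
open Literature.RepresentationTheory.CompactGroups.CompactGroup (unitarize unitarize_mem_unitaryGroup trace_unitarize
  unitarize_inv star_unitarize_mul_self norm_unitarize_apply_le_one)

namespace Summit.QuantumFields.GaugeBoot

namespace HaarCovering

/-! ## The covering lemma -/

section Covering

variable {G : Type*} [Group G] [MeasurableSpace G] [MeasurableMul G]

/-- **Covering lemma.** If `cell : G → α` takes values in the finite set `S` and elements of one cell
differ by an element of `B` (`cell g = cell h → h⁻¹ g ∈ B`), then `μ(G) ≤ #S · μ(B)` for every
left-invariant measure `μ`: each cell lies in a left translate of `B`. [folklore] -/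
theorem measure_univ_le_card_mul (μ : Measure G) [μ.IsMulLeftInvariant] {α : Type*} (S : Finset α)
    (cell : G → α) (hS : ∀ g, cell g ∈ S) (B : Set G) (hB : ∀ g h, cell g = cell h → h⁻¹ * g ∈ B) :
    μ Set.univ ≤ S.card * μ B := by
  have hcover : (Set.univ : Set G) ⊆ ⋃ v ∈ S, cell ⁻¹' {v} := fun g _ =>
    Set.mem_iUnion₂.2 ⟨cell g, hS g, rfl⟩
  have hcell : ∀ v ∈ S, μ (cell ⁻¹' {v}) ≤ μ B := by
    intro v _
    rcases (cell ⁻¹' {v}).eq_empty_or_nonempty with hv | ⟨h, hh⟩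
    · rw [hv, measure_empty]; exact bot_le
    · calc μ (cell ⁻¹' {v}) ≤ μ ((fun k => h⁻¹ * k) ⁻¹' B) := by
            refine measure_mono fun g hg => hB g h ?_
            rw [Set.mem_preimage, Set.mem_singleton_iff] at hg hh
            rw [hg, hh]
        _ = μ B := measure_preimage_mul μ h⁻¹ B
  calc μ Set.univ ≤ μ (⋃ v ∈ S, cell ⁻¹' {v}) := measure_mono hcover
    _ ≤ ∑ v ∈ S, μ (cell ⁻¹' {v}) := measure_biUnion_finset_le S _
    _ ≤ ∑ _v ∈ S, μ B := Finset.sum_le_sum hcell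
    _ = S.card * μ B := by rw [Finset.sum_const, nsmul_eq_mul]

/-- The covering lemma for a probability measure, in the form used below: `ofReal c ≤ μ(B)` as soon as
`c · #S ≤ 1`. [folklore] -/
theorem ofReal_le_measure_of_mul_card_le_one (μ : Measure G) [IsProbabilityMeasure μ] [μ.IsMulLeftInvariant]
    {α : Type*} (S : Finset α) (cell : G → α) (hS : ∀ g, cell g ∈ S) (B : Set G)
    (hB : ∀ g h, cell g = cell h → h⁻¹ * g ∈ B) {c : ℝ} (hc : 0 ≤ c) (hcS : c * S.card ≤ 1) :
    ENNReal.ofReal c ≤ μ B := by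
  have h := measure_univ_le_card_mul μ S cell hS B hB
  rw [measure_univ] at h
  calc ENNReal.ofReal c = ENNReal.ofReal c * 1 := (mul_one _).symm
    _ ≤ ENNReal.ofReal c * (S.card * μ B) := by gcongr
    _ = ENNReal.ofReal (c * S.card) * μ B := by
        rw [← mul_assoc, ENNReal.ofReal_mul hc, ENNReal.ofReal_natCast]
    _ ≤ 1 * μ B := by gcongr; exact ENNReal.ofReal_le_one.2 hcS
    _ = μ B := one_mul _

end Covering

/-! ## The trace cost `N − Re tr ρ(g)` as a Hilbert–Schmidt distance -/

section TraceCost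

variable {N : ℕ} {G : Type*} [Group G] [TopologicalSpace G] [IsTopologicalGroup G] [CompactSpace G]
  (ρ : G →* Matrix (Fin N) (Fin N) ℂ)

/-- `N − Re tr ρ(g) = ‖1 − σ(g)‖²_F / 2` with `σ = unitarize ρ` (same character, unitary values; the
tree's `UnitaryCayley.re_trace_one_sub`). [folklore] -/
theorem sub_re_trace_eq_norm_sq (hρ : Continuous ρ) (g : G) :
    (N : ℝ) - ((ρ g).trace).re = ‖(1 : Matrix (Fin N) (Fin N) ℂ) - unitarize ρ hρ g‖ ^ 2 / 2 := by
  rw [← trace_unitarize ρ hρ g, ← UnitaryCayley.re_trace_one_sub (unitarize_mem_unitaryGroup ρ hρ g),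
    Matrix.trace_sub, Matrix.trace_one, Complex.sub_re, Fintype.card_fin, Complex.natCast_re]

/-- ★ **The trace cost of `h⁻¹g` is half the squared Hilbert–Schmidt distance of `σ(g)` and `σ(h)`**:
`N − Re tr ρ(h⁻¹g) = ‖σ(g) − σ(h)‖²_F / 2`. [folklore] -/
theorem sub_re_trace_inv_mul_eq (hρ : Continuous ρ) (g h : G) :
    (N : ℝ) - ((ρ (h⁻¹ * g)).trace).re = ‖unitarize ρ hρ g - unitarize ρ hρ h‖ ^ 2 / 2 := by
  rw [sub_re_trace_eq_norm_sq ρ hρ, map_mul, unitarize_inv ρ hρ h]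
  have h1 : (1 : Matrix (Fin N) (Fin N) ℂ) - star (unitarize ρ hρ h) * unitarize ρ hρ g =
      star (unitarize ρ hρ h) * (unitarize ρ hρ h - unitarize ρ hρ g) := by
    rw [Matrix.mul_sub, star_unitarize_mul_self ρ hρ h]
  have hu : star (unitarize ρ hρ h) ∈ Matrix.unitaryGroup (Fin N) ℂ :=
    Unitary.star_mem (unitarize_mem_unitaryGroup ρ hρ h)
  have h2 : ‖star (unitarize ρ hρ h) * (unitarize ρ hρ h - unitarize ρ hρ g)‖ = ‖unitarize ρ hρ h - unitarize ρ hρ g‖ :=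
    Matrix.frobenius_norm_unitaryGroup_mul ⟨star (unitarize ρ hρ h), hu⟩ _
  rw [h1, h2, norm_sub_rev]

/-- Entrywise closeness controls the trace cost: if the real and imaginary parts of all entries of
`σ(g)` and `σ(h)` differ by at most `s`, then `N − Re tr ρ(h⁻¹g) ≤ N²·s²`. [folklore] -/
theorem sub_re_trace_inv_mul_le_of_entries (hρ : Continuous ρ) {s : ℝ} (g h : G)
    (hre : ∀ a b, |(unitarize ρ hρ g a b).re - (unitarize ρ hρ h a b).re| ≤ s)
    (him : ∀ a b, |(unitarize ρ hρ g a b).im - (unitarize ρ hρ h a b).im| ≤ s) :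
    (N : ℝ) - ((ρ (h⁻¹ * g)).trace).re ≤ (N : ℝ) ^ 2 * s ^ 2 := by
  rw [sub_re_trace_inv_mul_eq ρ hρ, UnitaryCayley.frobenius_norm_sq]
  have hentry : ∀ a b, ‖(unitarize ρ hρ g - unitarize ρ hρ h) a b‖ ^ 2 ≤ 2 * s ^ 2 := by
    intro a b
    rw [Matrix.sub_apply, Complex.sq_norm, Complex.normSq_apply, Complex.sub_re, Complex.sub_im]
    have h1 := hre a b
    have h2 := him a b
    have h1' := sq_abs ((unitarize ρ hρ g a b).re - (unitarize ρ hρ h a b).re)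
    have h2' := sq_abs ((unitarize ρ hρ g a b).im - (unitarize ρ hρ h a b).im)
    nlinarith [abs_nonneg ((unitarize ρ hρ g a b).re - (unitarize ρ hρ h a b).re),
      abs_nonneg ((unitarize ρ hρ g a b).im - (unitarize ρ hρ h a b).im)]
  calc (∑ a, ∑ b, ‖(unitarize ρ hρ g - unitarize ρ hρ h) a b‖ ^ 2) / 2
      ≤ (∑ _a : Fin N, ∑ _b : Fin N, 2 * s ^ 2) / 2 := by
        gcongr with a _ b _
        exact hentry a b
    _ = (N : ℝ) ^ 2 * s ^ 2 := by
        simp only [Finset.sum_const, Finset.card_univ, Fintype.card_fin]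
        ring

/-- Entries of the unitarised representation have real and imaginary parts in `[−1, 1]`. [folklore] -/
theorem abs_re_entry_le_one (hρ : Continuous ρ) (g : G) (a b : Fin N) :
    |(unitarize ρ hρ g a b).re| ≤ 1 ∧ |(unitarize ρ hρ g a b).im| ≤ 1 :=
  ⟨(Complex.abs_re_le_norm _).trans (norm_unitarize_apply_le_one ρ hρ g a b),
    (Complex.abs_im_le_norm _).trans (norm_unitarize_apply_le_one ρ hρ g a b)⟩

end TraceCost

/-! ## Binning: equal floors are close -/

/-- Binning a coordinate `x ∈ [−1, 1]` by `⌊(x + 1)/s⌋₊`: equal bins force `|x − y| ≤ s` (the box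
principle; the floor step is the tree's `Waldschmidt1981.abs_sub_lt_one_of_floor_eq`, inlined). [folklore] -/
theorem abs_sub_le_of_bin_eq {x y s : ℝ} (hs : 0 < s) (hx : -1 ≤ x) (hy : -1 ≤ y)
    (h : ⌊(x + 1) / s⌋₊ = ⌊(y + 1) / s⌋₊) : |x - y| ≤ s := by
  -- two non-negative reals with the same natural floor differ by less than `1`
  have hlt : |(x + 1) / s - (y + 1) / s| < 1 := by
    have hu : 0 ≤ (x + 1) / s := div_nonneg (by linarith) hs.le
    have hv : 0 ≤ (y + 1) / s := div_nonneg (by linarith) hs.le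
    have h1 := Nat.floor_le hu
    have h2 := Nat.lt_floor_add_one ((x + 1) / s)
    have h3 := Nat.floor_le hv
    have h4 := Nat.lt_floor_add_one ((y + 1) / s)
    rw [h] at h1 h2
    rw [abs_sub_lt_iff]
    constructor <;> linarith
  rw [← sub_div, abs_div, abs_of_pos hs, div_lt_one hs] at hlt
  have : x + 1 - (y + 1) = x - y := by ring
  rw [this] at hlt
  exact hlt.le

/-- The bin index of `x ∈ [−1, 1]` is at most `⌊2/s⌋₊`. [folklore] -/
theorem bin_le {x s : ℝ} (hs : 0 < s) (hx : x ≤ 1) : ⌊(x + 1) / s⌋₊ ≤ ⌊2 / s⌋₊ :=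
  Nat.floor_le_floor (div_le_div_of_nonneg_right (by linarith) hs.le)

/-! ## The small-ball bound -/

section SmallBall

variable {N : ℕ} {G : Type*} [Group G] [TopologicalSpace G] [IsTopologicalGroup G] [CompactSpace G]
  [MeasurableSpace G] [BorelSpace G] (ρ : G →* Matrix (Fin N) (Fin N) ℂ)

/-- ★★ **Chart-free small-ball bound.** For every compact group `G`, every continuous `N`-dimensional
representation `ρ` (`N ≥ 1`), every left-invariant probability measure `μ` on `G` and `0 < η ≤ 1`:
`μ{g : N − Re tr ρ(g) ≤ η} ≥ (η/(9N²))^{N²}`.  Proof: bin the `2N²` real coordinates of the unitarised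
`σ(g)` into intervals of length `s = √η/N`; there are at most `(⌊2/s⌋ + 1)^{2N²} ≤ (9N²/η)^{N²}` cells and
one cell lies in a left translate of the set (`sub_re_trace_inv_mul_le_of_entries`). [folklore] -/
theorem le_measure_setOf_sub_re_trace_le (μ : Measure G) [IsProbabilityMeasure μ] [μ.IsMulLeftInvariant]
    (hρ : Continuous ρ) (hN : N ≠ 0) {η : ℝ} (hη0 : 0 < η) (hη1 : η ≤ 1) :
    ENNReal.ofReal ((η / (9 * (N : ℝ) ^ 2)) ^ (N ^ 2)) ≤ μ {g : G | (N : ℝ) - ((ρ g).trace).re ≤ η} := by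
  classical
  have hN' : (0 : ℝ) < N := by exact_mod_cast Nat.pos_of_ne_zero hN
  have hN1 : (1 : ℝ) ≤ N := by exact_mod_cast Nat.one_le_iff_ne_zero.2 hN
  -- the bin width
  set s : ℝ := Real.sqrt η / N with hs
  have hsη : Real.sqrt η ≤ 1 := by rw [← Real.sqrt_one]; exact Real.sqrt_le_sqrt hη1
  have hs0 : 0 < s := by rw [hs]; exact div_pos (Real.sqrt_pos.2 hη0) hN'
  have hs1 : s ≤ 1 := by rw [hs, div_le_one hN']; exact hsη.trans hN1
  have hs2 : (N : ℝ) ^ 2 * s ^ 2 = η := by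
    rw [hs, div_pow, Real.sq_sqrt hη0.le]; field_simp
  -- the cells
  set cell : G → (Fin N × Fin N → ℕ × ℕ) := fun g ab =>
    (⌊((unitarize ρ hρ g ab.1 ab.2).re + 1) / s⌋₊, ⌊((unitarize ρ hρ g ab.1 ab.2).im + 1) / s⌋₊) with hcell
  set S : Finset (Fin N × Fin N → ℕ × ℕ) :=
    Fintype.piFinset fun _ => Finset.range (⌊2 / s⌋₊ + 1) ×ˢ Finset.range (⌊2 / s⌋₊ + 1) with hSdef
  have hS : ∀ g, cell g ∈ S := by
    intro g
    rw [hSdef]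
    refine Fintype.mem_piFinset.2 fun ab => Finset.mem_product.2 ⟨?_, ?_⟩
    · exact Finset.mem_range.2 (Nat.lt_succ_of_le
        (bin_le hs0 (abs_le.1 (abs_re_entry_le_one ρ hρ g ab.1 ab.2).1).2))
    · exact Finset.mem_range.2 (Nat.lt_succ_of_le
        (bin_le hs0 (abs_le.1 (abs_re_entry_le_one ρ hρ g ab.1 ab.2).2).2))
  have hB : ∀ g h, cell g = cell h → h⁻¹ * g ∈ {k : G | (N : ℝ) - ((ρ k).trace).re ≤ η} := by
    intro g h hgh
    show (N : ℝ) - ((ρ (h⁻¹ * g)).trace).re ≤ η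
    rw [← hs2]
    refine sub_re_trace_inv_mul_le_of_entries ρ hρ g h (fun a b => ?_) (fun a b => ?_)
    · have e := congrArg Prod.fst (congrFun hgh (a, b))
      simp only [hcell] at e
      exact abs_sub_le_of_bin_eq hs0 (abs_le.1 (abs_re_entry_le_one ρ hρ g a b).1).1
        (abs_le.1 (abs_re_entry_le_one ρ hρ h a b).1).1 e
    · have e := congrArg Prod.snd (congrFun hgh (a, b))
      simp only [hcell] at e
      exact abs_sub_le_of_bin_eq hs0 (abs_le.1 (abs_re_entry_le_one ρ hρ g a b).2).1
        (abs_le.1 (abs_re_entry_le_one ρ hρ h a b).2).1 e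
  -- counting: `#S = ((M+1)²)^{N²} ≤ (9N²/η)^{N²}`, `M = ⌊2/s⌋`
  have hcard : (S.card : ℝ) = (((⌊2 / s⌋₊ : ℝ) + 1) ^ 2) ^ (N ^ 2) := by
    rw [hSdef, Fintype.card_piFinset, Finset.prod_const, Finset.card_univ, Finset.card_product, Finset.card_range,
      Fintype.card_prod, Fintype.card_fin]
    push_cast
    ring
  have hM1 : (⌊2 / s⌋₊ : ℝ) + 1 ≤ 3 / s := by
    have h1 : (⌊2 / s⌋₊ : ℝ) ≤ 2 / s := Nat.floor_le (by positivity)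
    have h2 : (1 : ℝ) ≤ 1 / s := by rw [le_div_iff₀ hs0]; linarith
    have : 2 / s + 1 / s = 3 / s := by ring
    linarith
  have hM2 : ((⌊2 / s⌋₊ : ℝ) + 1) ^ 2 ≤ 9 * (N : ℝ) ^ 2 / η := by
    have h9 : (3 / s) ^ 2 = 9 * (N : ℝ) ^ 2 / η := by
      rw [div_pow, ← hs2]; field_simp; ring
    rw [← h9]
    exact pow_le_pow_left₀ (by positivity) hM1 2
  have hc0 : (0 : ℝ) ≤ (η / (9 * (N : ℝ) ^ 2)) ^ (N ^ 2) := by positivity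
  refine ofReal_le_measure_of_mul_card_le_one μ S cell hS _ hB hc0 ?_
  rw [hcard]
  calc (η / (9 * (N : ℝ) ^ 2)) ^ (N ^ 2) * (((⌊2 / s⌋₊ : ℝ) + 1) ^ 2) ^ (N ^ 2)
      ≤ (η / (9 * (N : ℝ) ^ 2)) ^ (N ^ 2) * (9 * (N : ℝ) ^ 2 / η) ^ (N ^ 2) := by
        gcongr
    _ = 1 := by
        rw [← mul_pow, div_mul_div_comm, mul_comm η, div_self (by positivity), one_pow]

/-- The bound for the tree's normalised Haar measure `haarProbability G`. [folklore] -/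
theorem le_haarProbability_setOf_sub_re_trace_le (hρ : Continuous ρ) (hN : N ≠ 0) {η : ℝ} (hη0 : 0 < η)
    (hη1 : η ≤ 1) :
    ENNReal.ofReal ((η / (9 * (N : ℝ) ^ 2)) ^ (N ^ 2)) ≤
      haarProbability G {g : G | (N : ℝ) - ((ρ g).trace).re ≤ η} := by
  haveI : (haarProbability G).IsMulLeftInvariant := by unfold haarProbability; infer_instance
  exact le_measure_setOf_sub_re_trace_le ρ _ hρ hN hη0 hη1

end SmallBall

/-- The bound for `SU(N)` in the fundamental representation: for `N ≥ 1` and `0 < η ≤ 1`,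
`Haar_{SU(N)}{U : N − Re tr U ≤ η} ≥ (η/(9N²))^{N²}`. [folklore] -/
theorem le_haarProbability_suN_sub_re_trace_le {N : ℕ} (hN : N ≠ 0) {η : ℝ} (hη0 : 0 < η) (hη1 : η ≤ 1) :
    ENNReal.ofReal ((η / (9 * (N : ℝ) ^ 2)) ^ (N ^ 2)) ≤
      haarProbability (SU N) {U : SU N | (N : ℝ) - ((U : Matrix (Fin N) (Fin N) ℂ).trace).re ≤ η} := by
  have h := le_haarProbability_setOf_sub_re_trace_le (suRep N) (continuous_suRep N) hN hη0 hη1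
  simpa only [Literature.MathematicalPhysics.QuantumLattice.fundamentalRep_apply] using h

end HaarCovering

end Summit.QuantumFields.GaugeBoot

end
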